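import Literature.Probability.LatticeModels.CriticalTwoPointDCPLowerHolds
import HarnessLib

/-!
# The screening identity behind the engine of line `source-cluster-screening`
# (crux stmt-CriticalPhenomena-15703 `Summit.CriticalPhenomena.Ising3DConformalLimit.Theses.SubPtolemyInterlacing.SubPtolemyFloor`,
# engine stub `stub_screenedLemma25`; lead seat `prover-line-stmt-CriticalPhenomena-15703-c3-0`)

The tree proves steps (3)–(4) of Duminil-Copin–Panis' Lemma 2.5 (arXiv:2404.05700, §2.2, eq. (2.23)) as
INEQUALITIES (`IsFoldable.tsum_outer_connFix_le`, `IsFoldable.tsum_cset_connFix_le`): conditionally on the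
source cluster `𝒞(o) = S`, the probability that the outer sourceless current joins `y` to the hyperplane is
`Z^∅_{Λ∖S}[y ↔ ℍ]/Z^∅_{Λ∖S} = ⟨σ_yσ_{θy}⟩_{Λ∖S}` (switching for reflected currents, EXACT) `≤ ⟨σ_yσ_{θy}⟩_Λ`
(Griffiths — the step that throws the SCREENING away). This file proves the exact versions, for an abstract
fold datum, and assembles them into the **screening identity**

  `Z^{{o,x}}[o ↮ ℍ, x ↮ ℍ, y ↔ ℍ] = Σ_{S} ⟨σ_yσ_{θy}⟩_{Λ∖S} · Z^{{o,x}}[𝒞(o) = S]`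

(`sourcedEvent_eq_screening`; the sum is over the admissible values of the source cluster: symmetric, no
fixed vertex, `o, x ∈ S`, `y ∉ S`). Consequently the SCREENED SOURCED-EVENT bound of
`SubPtolemyFloorScreening.screenedLemma25_of_screenedSourcedEvent` (which implies the engine) reads, after
dividing by the un-screened `Σ_S ⟨σ_yσ_{θy}⟩_Λ Z^{{o,x}}[𝒞(o) = S] ≤ ⟨σ_yσ_{θy}⟩_Λ (Z^{{o,x}} - Z^{{o,θx}})`
(`screening_dropped_le`, the tree's steps (4)–(5)): "the `B(n)`-weighted mean SCREENING RATIO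
`⟨σ_yσ_{θy}⟩_{Λ∖𝒞(o)} / ⟨σ_yσ_{θy}⟩_Λ` of the reflected connection of the neighbour `y` of `x` by the source
cluster `𝒞(o) ∋ x` decays like `n^{-s}`" — a non-intersection exponent of two adjacent-rooted critical
current clusters, the content of the engine.

* `outer_connFix_eq` — `Z^∅_{ℰ_K}[y ↔_ℳ ℍ] = ⟨σ_yσ_{θy}⟩_K · Z^∅_{ℰ_K}` (`K` symmetric, `y ∈ K` in `H₋ ∪ Fix`);
* `cset_connFix_eq` — `Z^{{o,x}}[𝒞(o) = S, y ↔ ℍ] = ⟨σ_yσ_{θy}⟩_{Λ∖S} · Z^{{o,x}}[𝒞(o) = S]`;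
* `sourcedEvent_eq_screening` — the identity above;
* `screening_dropped_le` — `Σ_S ⟨σ_yσ_{θy}⟩_Λ Z^{{o,x}}[𝒞(o) = S] ≤ ⟨σ_yσ_{θy}⟩_Λ (Z^{{o,x}} - Z^{{o,θx}})`.

No definition, no named fact; random-current bookkeeping over the tree's `ReflectedCurrents.lean`,
`FieldCurrents.lean`, `CriticalTwoPointDCPLowerLemma25.lean`.

References: H. Duminil-Copin, R. Panis, CMP 406 (2025), arXiv:2404.05700, Lemma 2.5 (proof, eqs. (2.22)–(2.23))
and Lemma 2.3 (switching for reflected currents); H. Duminil-Copin, arXiv:1607.06933, §2.2.1 (random-current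
representation of `⟨σ_aσ_b⟩`).
-/

noncomputable section

open Finset

namespace Summit.CriticalPhenomena.Ising3DConformalLimit.SubPtolemyFloorScreening

open Literature.Probability.LatticeModels
open scoped ENNReal symmDiff Classical

variable {V : Type*} [DecidableEq V] {G : SimpleGraph V} [G.LocallyFinite] {θ : V ≃ V} {Λ Hm : Finset V}

/-- **Exact outer switching** (Duminil-Copin–Panis 2025, proof of Lemma 2.5, eq. (2.23) with Lemma 2.3, the
Griffiths step removed): for `K ⊆ Λ` symmetric and `y ∈ K` in `H₋ ∪ Fix`,
`Z^∅_{ℰ_K}[y ↔_ℳ ℍ] = ⟨σ_yσ_{θy}⟩_K · Z^∅_{ℰ_K}` — switching turns the event `y ↔_ℳ ℍ` of the sourceless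
current into the sources `{y, θy}`, for which the event is automatic (handshake), and
`Z_{ℰ_K}({y,θy}) = ⟨σ_yσ_{θy}⟩_K Z_{ℰ_K}(∅)`. [cite: DuminilCopinPanis2025LowerBounds, Lemma 2.5 (proof, eq. (2.23)) and Lemma 2.3] -/
theorem outer_connFix_eq (h : IsFoldable G θ Λ Hm) {β : ℝ} (hβ : 0 ≤ β) {K : Finset V} (hK : K ⊆ Λ)
    (hsymmK : h.Symm K) {y : V} (hyK : y ∈ K) (hy' : y ∈ Hm ∨ θ y = y) :
    ∑' n, ind (csources G Λ n = ∅ ∧ CSupp G Λ (edgesIn G K) n) * cweight G Λ β n * ind (h.ConnFix (h.fold n) y) =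
      ENNReal.ofReal (isingTwoPoint G K β 0 .free y (θ y)) * currentZ G Λ β (edgesIn G K) ∅ := by
  have hyΛ : y ∈ Λ := hK hyK
  rcases hy' with hym | hfix
  · have hθyK : θ y ∈ K := (hsymmK y).1 hyK
    have hθy : θ y ∉ Hm := h.left_disjoint y hym
    -- after switching, the event is automatic (handshake)
    have hauto : ∀ n, ind (csources G Λ n = ∅ ∆ ({y} ∆ {θ y}) ∧ CSupp G Λ (edgesIn G K) n) * cweight G Λ β n *
        ind (h.ConnFix (h.fold n) y) =
        ind (csources G Λ n = ∅ ∆ ({y} ∆ {θ y}) ∧ CSupp G Λ (edgesIn G K) n) * cweight G Λ β n := by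
      intro n
      by_cases hsrc : csources G Λ n = ∅ ∆ ({y} ∆ {θ y}) ∧ CSupp G Λ (edgesIn G K) n
      · rw [ind_of_true (h.connFix_fold_of_sources n hym fun v hv => ?_), mul_one]
        rw [hsrc.1, show (∅ : Finset V) ∆ ({y} ∆ {θ y}) = {y} ∆ {θ y} from bot_symmDiff _, mem_symmDiff,
          mem_singleton, mem_singleton]
        constructor
        · rintro (⟨rfl, -⟩ | ⟨rfl, -⟩)
          · rfl
          · exact absurd hv hθy
        · rintro rfl
          exact Or.inl ⟨rfl, fun hyy => h.apply_ne_of_mem hym hyy.symm⟩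
      · rw [ind_of_false hsrc, zero_mul, zero_mul]
    calc ∑' n, ind (csources G Λ n = ∅ ∧ CSupp G Λ (edgesIn G K) n) * cweight G Λ β n * ind (h.ConnFix (h.fold n) y)
        = ∑' n, ind (csources G Λ n = ∅ ∆ ({y} ∆ {θ y}) ∧ CSupp G Λ (edgesIn G K) n) * cweight G Λ β n *
            ind (h.ConnFix (h.fold n) y) := h.tsum_switch_reflected_eq ∅ (h.edgesIn_symm_iff hsymmK) hym hβ
      _ = currentZ G Λ β (edgesIn G K) ({y} ∆ {θ y}) := by
          unfold currentZ
          refine tsum_congr fun n => ?_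
          rw [hauto n, show (∅ : Finset V) ∆ ({y} ∆ {θ y}) = {y} ∆ {θ y} from bot_symmDiff _]
      _ = ENNReal.ofReal (isingTwoPoint G K β 0 .free y (θ y)) * currentZ G Λ β (edgesIn G K) ∅ :=
          IsFoldable.currentZ_edgesIn_pair_eq hβ hK hyK hθyK
  · have h1 : ∀ n, ind (h.ConnFix (h.fold n) y) = 1 := fun n => ind_of_true (h.connFix_of_fixed _ hyΛ hfix)
    simp_rw [h1, mul_one]
    rw [hfix, isingTwoPoint_self, ENNReal.ofReal_one, one_mul]
    unfold currentZ
    rfl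

/-- **Conditionally on the source cluster, the reflected connection of `y` is realised OFF it, exactly**
(Duminil-Copin–Panis 2025, proof of Lemma 2.5, eq. (2.23) without the Griffiths step): for `S ⊆ Λ` symmetric
without fixed vertices, `o ∈ S ∩ H₋`, `x ∈ S`, `y ∈ Λ ∖ S` in `H₋ ∪ Fix`,
`Z^{{o,x}}[𝒞(o) = S, y ↔ ℍ] = ⟨σ_yσ_{θy}⟩_{Λ∖S} · Z^{{o,x}}[𝒞(o) = S]`. [cite: DuminilCopinPanis2025LowerBounds, Lemma 2.5 (proof, eq. (2.23))] -/
theorem cset_connFix_eq (h : IsFoldable G θ Λ Hm) {β : ℝ} (hβ : 0 ≤ β) {S : Finset V} (hS : S ⊆ Λ)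
    (hsymm : h.Symm S) (hnofix : ∀ v ∈ S, θ v ≠ v) {o x y : V} (ho : o ∈ Hm) (hoS : o ∈ S) (hxS : x ∈ S)
    (hyΛ : y ∈ Λ) (hyS : y ∉ S) (hy' : y ∈ Hm ∨ θ y = y) :
    ∑' n, ind (csources G Λ n = {o} ∆ {x} ∧ CSupp G Λ (edgesIn G Λ) n) * cweight G Λ β n *
        (ind (h.cset n o = S) * ind (h.ConnFix (h.fold n) y)) =
      ENNReal.ofReal (isingTwoPoint G (Λ \ S) β 0 .free y (θ y)) *
        ∑' n, ind (csources G Λ n = {o} ∆ {x} ∧ CSupp G Λ (edgesIn G Λ) n) * cweight G Λ β n * ind (h.cset n o = S) := by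
  have hsymm' : h.Symm (Λ \ S) := h.symm_sdiff hsymm
  have hyK : y ∈ Λ \ S := mem_sdiff.2 ⟨hyΛ, hyS⟩
  have hA : ({o} : Finset V) ∆ {x} ⊆ S := fun v hv => by
    rw [mem_symmDiff, mem_singleton, mem_singleton] at hv
    rcases hv with ⟨rfl, -⟩ | ⟨rfl, -⟩ <;> assumption
  -- the characterisations across the cut
  have hchar1 : ∀ n, ind (h.cset n o = S) * ind (h.ConnFix (h.fold n) y) =
      ind (CSupp G Λ (edgesIn G S ∪ edgesIn G (Λ \ S)) n) *
        (ind (h.cset (crestr G Λ (edgesIn G S) n) o = S) *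
          ind (h.ConnFix (h.fold (crestr G Λ (edgesIn G (Λ \ S)) n)) y)) := by
    intro n
    rw [ind_congr (h.cset_eq_iff ho hsymm hnofix hoS), ind_and, mul_assoc]
    by_cases hcut : CSupp G Λ (edgesIn G S ∪ edgesIn G (Λ \ S)) n
    · rw [ind_of_true hcut, one_mul, one_mul,
        ind_congr (h.connFix_iff_connFix_crestr hsymm' (IsFoldable.csupp_cut_comm hS hcut) hyK)]
    · rw [ind_of_false hcut, zero_mul, zero_mul]
  have hchar2 : ∀ n, ind (h.cset n o = S) =
      ind (CSupp G Λ (edgesIn G S ∪ edgesIn G (Λ \ S)) n) *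
        (ind (h.cset (crestr G Λ (edgesIn G S) n) o = S) * (fun _ => (1 : ℝ≥0∞)) (crestr G Λ (edgesIn G (Λ \ S)) n)) := by
    intro n
    rw [ind_congr (h.cset_eq_iff ho hsymm hnofix hoS), ind_and, mul_one]
  simp_rw [hchar1]
  rw [IsFoldable.tsum_cut_factor β hA (fun m => ind (h.cset m o = S)) (fun m => ind (h.ConnFix (h.fold m) y))]
  have hZ2 : (∑' n, ind (csources G Λ n = {o} ∆ {x} ∧ CSupp G Λ (edgesIn G Λ) n) * cweight G Λ β n *
      ind (h.cset n o = S)) = (∑' n₁, ind (csources G Λ n₁ = {o} ∆ {x} ∧ CSupp G Λ (edgesIn G S) n₁) *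
        cweight G Λ β n₁ * ind (h.cset n₁ o = S)) * currentZ G Λ β (edgesIn G (Λ \ S)) ∅ := by
    rw [show (∑' n, ind (csources G Λ n = {o} ∆ {x} ∧ CSupp G Λ (edgesIn G Λ) n) * cweight G Λ β n *
        ind (h.cset n o = S)) = ∑' n, ind (csources G Λ n = {o} ∆ {x} ∧ CSupp G Λ (edgesIn G Λ) n) * cweight G Λ β n *
        (ind (CSupp G Λ (edgesIn G S ∪ edgesIn G (Λ \ S)) n) *
          (ind (h.cset (crestr G Λ (edgesIn G S) n) o = S) * (fun _ => (1 : ℝ≥0∞)) (crestr G Λ (edgesIn G (Λ \ S)) n)))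
        from tsum_congr fun n => by rw [hchar2 n],
      IsFoldable.tsum_cut_factor β hA (fun m => ind (h.cset m o = S)) (fun _ => (1 : ℝ≥0∞))]
    unfold currentZ
    simp only [mul_one]
  rw [hZ2, outer_connFix_eq h hβ sdiff_subset hsymm' hyK hy', mul_left_comm]

/-- **The screening identity.** For a fold datum, `β ≥ 0`, `o, x ∈ H₋` and `y ∈ Λ` in `H₋ ∪ Fix`:
`Σ_{∂𝐧={o}∆{x}} w(𝐧) 𝟙[o ↮ ℍ, x ↮ ℍ, y ↔ ℍ] = Σ_{S} ⟨σ_yσ_{θy}⟩_{Λ∖S} · Σ_{∂𝐧={o}∆{x}} w(𝐧) 𝟙[𝒞_𝐧(o) = S]`,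
the sum over `S ⊆ Λ` symmetric, without fixed vertex, `o, x ∈ S`, `y ∉ S` (the possible source clusters on the
event). That is, `Z^{{o,x}}[o,x ↮ ℍ, y ↔ ℍ] = 𝐄^{{o,x}}[𝟙_{o ↮ ℍ, y ∉ 𝒞(o)} ⟨σ_yσ_{θy}⟩_{Λ∖𝒞(o)}]·Z^{{o,x}}`: the
reflected connection of `y` must be made by the sourceless loops in the complement of the source cluster
`𝒞(o) ∋ x ∼ y`, whose two-point function `⟨σ_yσ_{θy}⟩_{Λ∖𝒞(o)}` is the SCREENED one. [cite: DuminilCopinPanis2025LowerBounds, Lemma 2.5 (proof, eqs. (2.22)–(2.23))] -/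
theorem sourcedEvent_eq_screening (h : IsFoldable G θ Λ Hm) {β : ℝ} (hβ : 0 ≤ β) {o x y : V} (ho : o ∈ Hm)
    (hx : x ∈ Hm) (hyΛ : y ∈ Λ) (hy' : y ∈ Hm ∨ θ y = y) :
    ∑' n, ind (csources G Λ n = {o} ∆ {x} ∧ CSupp G Λ (edgesIn G Λ) n) * cweight G Λ β n *
        ind (¬ h.ConnFix (h.fold n) o ∧ ¬ h.ConnFix (h.fold n) x ∧ h.ConnFix (h.fold n) y) =
      ∑ S ∈ Λ.powerset.filter (fun S => h.Symm S ∧ (∀ v ∈ S, θ v ≠ v) ∧ o ∈ S ∧ x ∈ S ∧ y ∉ S),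
        ENNReal.ofReal (isingTwoPoint G (Λ \ S) β 0 .free y (θ y)) *
          ∑' n, ind (csources G Λ n = {o} ∆ {x} ∧ CSupp G Λ (edgesIn G Λ) n) * cweight G Λ β n *
            ind (h.cset n o = S) := by
  have hoΛ : o ∈ Λ := h.left_subset ho
  have hxΛ : x ∈ Λ := h.left_subset hx
  set wt : (edgesIn G Λ → ℕ) → ℝ≥0∞ := fun n =>
    ind (csources G Λ n = {o} ∆ {x} ∧ CSupp G Λ (edgesIn G Λ) n) * cweight G Λ β n with hwt
  set Fam : Finset (Finset V) := Λ.powerset.filter fun S =>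
    h.Symm S ∧ (∀ v ∈ S, θ v ≠ v) ∧ o ∈ S ∧ x ∈ S ∧ y ∉ S with hFam
  -- Step A (pointwise, an EQUALITY): condition on `𝒞_n(o)`
  have hA : ∀ n, wt n * ind (¬ h.ConnFix (h.fold n) o ∧ ¬ h.ConnFix (h.fold n) x ∧ h.ConnFix (h.fold n) y) =
      ∑ S ∈ Fam, wt n * (ind (h.cset n o = S) * ind (h.ConnFix (h.fold n) y)) := by
    intro n
    by_cases hsrc : csources G Λ n = {o} ∆ {x} ∧ CSupp G Λ (edgesIn G Λ) n
    · rw [← mul_sum]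
      congr 1
      by_cases hmem : h.cset n o ∈ Fam
      · -- the cluster is admissible: `o, x ↮ ℍ` automatically, one value of `S`
        have hmem' := hmem
        rw [hFam, mem_filter] at hmem'
        have hno : ¬ h.ConnFix (h.fold n) o := h.not_connFix_of_cset_nofix hmem'.2.2.1
        have hnx : ¬ h.ConnFix (h.fold n) x := h.not_connFix_x_of_not_connFix_o ho hx hsrc.1 hno
        rw [sum_eq_single (h.cset n o), ind_of_true rfl, one_mul]
        · exact ind_congr ⟨fun hP => hP.2.2, fun hy => ⟨hno, hnx, hy⟩⟩
        · intro S _ hS; rw [ind_of_false (show ¬ (h.cset n o = S) from fun h' => hS h'.symm), zero_mul]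
        · intro hn; exact absurd hmem hn
      · -- not admissible: the event fails and every term vanishes
        rw [sum_eq_zero fun S hS => by
          rw [ind_of_false (show ¬ (h.cset n o = S) from fun h' => hmem (h' ▸ hS)), zero_mul]]
        refine ind_of_false fun hP => hmem ?_
        rw [hFam, mem_filter, mem_powerset]
        refine ⟨h.cset_subset n o, h.symm_cset n o, fun v hv => h.nofix_of_mem_cset hP.1 hv,
          h.mem_cset_self n hoΛ, ?_, fun hyC => ?_⟩
        · exact (h.mem_cset_iff_cconn ho hxΛ (Or.inl hx)).2 (h.cconn_fold_of_csources_pair ho hx hsrc.1 hP.1)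
        · have hc := (h.mem_cset_iff_cconn ho hyΛ hy').1 hyC
          exact hP.1 ((h.connFix_iff_of_cconn hc).2 hP.2.2)
    · have h0 : wt n = 0 := by rw [hwt]; simp only; rw [ind_of_false hsrc, zero_mul]
      simp only [h0, zero_mul, sum_const_zero]
  -- Step B: sum over `S` and use the exact conditional identity termwise
  calc ∑' n, wt n * ind (¬ h.ConnFix (h.fold n) o ∧ ¬ h.ConnFix (h.fold n) x ∧ h.ConnFix (h.fold n) y)
      = ∑' n, ∑ S ∈ Fam, wt n * (ind (h.cset n o = S) * ind (h.ConnFix (h.fold n) y)) := tsum_congr hA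
    _ = ∑ S ∈ Fam, ∑' n, wt n * (ind (h.cset n o = S) * ind (h.ConnFix (h.fold n) y)) :=
        Summable.tsum_finsetSum (fun _ _ => ENNReal.summable)
    _ = ∑ S ∈ Fam, ENNReal.ofReal (isingTwoPoint G (Λ \ S) β 0 .free y (θ y)) * ∑' n, wt n * ind (h.cset n o = S) := by
        refine sum_congr rfl fun S hS => ?_
        rw [hFam, mem_filter, mem_powerset] at hS
        obtain ⟨hSΛ, hsymm, hnofix, hoS, hxS, hyS⟩ := hS
        exact cset_connFix_eq h hβ hSΛ hsymm hnofix ho hoS hxS hyΛ hyS hy'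

/-- **What dropping the screening costs nothing to state** (the tree's steps (4)–(5) in this vocabulary):
replacing each screened factor `⟨σ_yσ_{θy}⟩_{Λ∖S}` by the un-screened `⟨σ_yσ_{θy}⟩_Λ` gives at most
`⟨σ_yσ_{θy}⟩_Λ · (Z^{{o,x}} - Z^{{o,θx}})` (at most one admissible `S`, and admissibility forces `x ↮ ℍ`;
`Z^{{o,x}}[x ↮ ℍ] = Z^{{o,x}} - Z^{{o,θx}}`). Hence Lemma 2.5, and hence the engine with gain `n^{-s}` asks that the
weighted mean of the ratios `⟨σ_yσ_{θy}⟩_{Λ∖𝒞(o)}/⟨σ_yσ_{θy}⟩_Λ` be `≤ C n^{-s}`. [cite: DuminilCopinPanis2025LowerBounds, Lemma 2.5 (proof, the final display)] -/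
theorem screening_dropped_le (h : IsFoldable G θ Λ Hm) {β : ℝ} (hβ : 0 ≤ β) {o x y : V} (ho : o ∈ Hm)
    (hx : x ∈ Hm) :
    ∑ S ∈ Λ.powerset.filter (fun S => h.Symm S ∧ (∀ v ∈ S, θ v ≠ v) ∧ o ∈ S ∧ x ∈ S ∧ y ∉ S),
        ENNReal.ofReal (isingTwoPoint G Λ β 0 .free y (θ y)) *
          ∑' n, ind (csources G Λ n = {o} ∆ {x} ∧ CSupp G Λ (edgesIn G Λ) n) * cweight G Λ β n *
            ind (h.cset n o = S) ≤
      ENNReal.ofReal (isingTwoPoint G Λ β 0 .free y (θ y)) *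
        (currentZ G Λ β (edgesIn G Λ) ({o} ∆ {x}) - currentZ G Λ β (edgesIn G Λ) ({o} ∆ {θ x})) := by
  set wt : (edgesIn G Λ → ℕ) → ℝ≥0∞ := fun n =>
    ind (csources G Λ n = {o} ∆ {x} ∧ CSupp G Λ (edgesIn G Λ) n) * cweight G Λ β n with hwt
  set Fam : Finset (Finset V) := Λ.powerset.filter fun S =>
    h.Symm S ∧ (∀ v ∈ S, θ v ≠ v) ∧ o ∈ S ∧ x ∈ S ∧ y ∉ S with hFam
  rw [← mul_sum, ← Summable.tsum_finsetSum (fun _ _ => ENNReal.summable)]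
  refine mul_le_mul_right ?_ _
  -- at most one `S`, and it forces `x ↮ ℍ`
  have hC : ∀ n, ∑ S ∈ Fam, wt n * ind (h.cset n o = S) ≤ wt n * ind (¬ h.ConnFix (h.fold n) x) := by
    intro n
    rw [← mul_sum]
    by_cases hsrc : csources G Λ n = {o} ∆ {x} ∧ CSupp G Λ (edgesIn G Λ) n
    · refine mul_le_mul_right ?_ _
      by_cases hmem : h.cset n o ∈ Fam
      · rw [sum_eq_single (h.cset n o), ind_of_true rfl, ind_of_true]
        · rw [hFam, mem_filter] at hmem
          exact h.not_connFix_x_of_not_connFix_o ho hx hsrc.1 (h.not_connFix_of_cset_nofix hmem.2.2.1)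
        · intro S _ hS; exact ind_of_false fun h' => hS h'.symm
        · intro hn; exact absurd hmem hn
      · rw [sum_eq_zero fun S hS => ind_of_false (show ¬ (h.cset n o = S) from fun h' => hmem (h' ▸ hS))]
        exact bot_le
    · have h0 : wt n = 0 := by rw [hwt]; simp only; rw [ind_of_false hsrc, zero_mul]
      rw [h0, zero_mul, zero_mul]
  -- `Z^{{o,x}}[x ↮ ℍ] = Z^{{o,x}} - Z^{{o,θx}}`
  have hE : ∀ e ∈ edgesIn G Λ, e ∈ edgesIn G Λ ↔ Sym2.map θ e ∈ edgesIn G Λ := fun e he =>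
    ⟨fun he' => h.map_mem_edgesIn he', fun _ => he⟩
  have hD : ∑' n, wt n * ind (¬ h.ConnFix (h.fold n) x) =
      currentZ G Λ β (edgesIn G Λ) ({o} ∆ {x}) - currentZ G Λ β (edgesIn G Λ) ({o} ∆ {θ x}) :=
    ENNReal.eq_sub_of_add_eq (IsFoldable.currentZ_edgesIn_self_ne_top hβ _)
      (h.tsum_not_connFix_add_currentZ hβ hE ho hx)
  calc ∑' n, ∑ S ∈ Fam, wt n * ind (h.cset n o = S)
      ≤ ∑' n, wt n * ind (¬ h.ConnFix (h.fold n) x) := ENNReal.tsum_le_tsum hC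
    _ = _ := hD

end Summit.CriticalPhenomena.Ising3DConformalLimit.SubPtolemyFloorScreening

end
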